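import Summits.ResolutionOfSingularities.ResolutionOfSingularities.Theorems.SpreadCutLaw
import HarnessLib

/-!
# SpreadCutLaw2 — decomp-res node «SpreadCut» (lens-2 g19), file 2/4 of `SpreadCutLaw`

Content VERBATIM from the decomp-res lens-2 g19 node `HOME/decomp-res-lens-2/g19/SpreadCut.lean` (pin b2959d31, 3
579 l; HOME = run/shared/lean/pub/decomp-res);
CRITIC-LEDGER row 155 (DECIDED-MOD-PORT +1); landing orders INBOX :540: l. 143–2878 are `CylinderCut` d60dded1
VERBATIM (landed as `CylinderCutClasses` · `CylinderCutCells` ·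
`MaxContactCutCylinderCut`) and are DELETED here with the landed modules imported instead (namespaces
`…Theorems.PinchCut` / `JetCut` / `PurityCut` / `SplitCut` / `CylinderCut`
opened; same short names, byte-identical bodies — never two copies); NEW = §Γ (l. 2880–3336, the ring-level law +
§Γ.3 point level) and §V (l. 3338–3576, the spread cut).
Namespace `…Theorems.SpreadCut` (the lens's `Theses.SpreadCut` is gate-reserved), sub-namespace `Spread` as in the
lens; file split only (tree files ≤ 400 lines): sections,
variables, the `open MvPolynomial` lines and every declaration exactly as in the lens; the node's global
dupNamespace-linter line dropped.  Node files, in import order: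
`SpreadCutLaw` (§Γ + the cone-free head of §V; continued `…2` / `…3` where the cap cuts) · `SpreadCutCells` (§V2–§V4
cone-free: the aside home) · the wiring `MaxContactCutSpreadCut`
(§V BY NAME on the host route, in the Theses cone).  All `--supports stmt-ResolutionOfSingularities-29273`
(`MaxContactCut.RungOne`); nothing closes 29273 — decided halves
carry their engines as hypotheses (`SpreadExit` is a paper engine, not an item); exactly ONE located-residual aside
on the lens-2 column (`Spread.SpreadSpecialRung`, home
`SpreadCutCells`) SUPERSEDES g18's `Cyl.CylSpecialRung`, re-located EXACTLY modulo the spread decided half.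

§Γ (NEW, g19): LAW (Γ) — THE SECONDARY CURVE OF THE TOP CURVE read over `𝒪_C`, ring level: `binForm`, `lowerChart` /
`upperChart`, `RelSimple`, `SpreadShape` + kernels and the INSEP-v certificates (needs the tree's
`DeltaFaceCutClasses.qWeighted`); §Γ.3 point / curve level: `IsSpreadAt`, `IsUniformSpreadCurve`, the ENGINE `def
SpreadExit : Prop` (a paper engine: hypothesis, not an item), `IsSpreadCurvePt`, the decided class; and the
cone-free head of §V (`spreadLeaf = cylLeaf ∨ (Γ)` + order lemmas, the located residual class `IsSpreadSpecialPt` +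
iffs).  PROVED kernels, VERBATIM; continued `…2` where the 400-line cap cuts.

Part 2/4 carries: `lowerChart`, `upperChart`, `RelSimple`, `SpreadShape`, `binForm_lower`, `binForm_upper`,
`corner_chart`, `relSimple_of_sub_one_mem`, `relSimple_X_pow_add_C`, `not_relSimple_X_pow_add_C_of_mem_sq`,
`pureCoeff`, `binForm_pureCoeff`.

(Sources: Hironaka1964 Ch. III; CossartJannsenSaito2020 Ch. 2, Ch. 8–9; CossartPiltant2008 Prop. 4.2;
CossartPiltant2019 Rem. 3.2; BierstoneGrigorievMilmanWlodarczyk2011 §3.1; Moh1987; Hauser2010Kangaroo; Giraud1975;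
Narasimhan1983.)
-/

open CategoryTheory AlgebraicGeometry TopologicalSpace IsLocalRing
open Literature.AlgebraicGeometry.Resolution
open Summit.ResolutionOfSingularities.ResolutionOfSingularities.Theorems
open Summit.ResolutionOfSingularities.ResolutionOfSingularities.Theorems.WeakOrderReduction
open Summit.ResolutionOfSingularities.ResolutionOfSingularities.Theorems.DeltaFaceCutClasses
open Summit.ResolutionOfSingularities.ResolutionOfSingularities.Theorems.RelativeDeltaCut
open Summit.ResolutionOfSingularities.ResolutionOfSingularities.Theorems.CurveLeafExit
open Summit.ResolutionOfSingularities.ResolutionOfSingularities.Theorems.PinchCut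
open Summit.ResolutionOfSingularities.ResolutionOfSingularities.Theorems.JetCut
open Summit.ResolutionOfSingularities.ResolutionOfSingularities.Theorems.PurityCut
open Summit.ResolutionOfSingularities.ResolutionOfSingularities.Theorems.SplitCut
open Summit.ResolutionOfSingularities.ResolutionOfSingularities.Theorems.CylinderCut
open MvPolynomial

namespace Summit.ResolutionOfSingularities.ResolutionOfSingularities.Theorems.SpreadCut

section SpreadRing

variable {R : Type} [CommRing R]

/-- **LOWER CHART of the face** [g19] `lowerChart G m = Σ G i · X^i = Φ(X, 1) ∈ R[X]` — the equation of the
secondary curve in the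
affine chart `U₂ ≠ 0` of `ℙ¹_{𝒪_{Y,y}}` (coordinate `w = u₁/u₂`).  DEFINITION (NEW object). [folklore] -/
noncomputable def lowerChart (G : ℕ → R) (m : ℕ) : Polynomial R :=
  ∑ i ∈ Finset.range (m + 1), Polynomial.C (G i) * Polynomial.X ^ i

/-- **UPPER CHART of the face** [g19] `upperChart G m = Σ G i · X^(m-i) = Φ(1, X) ∈ R[X]` — the chart `U₁ ≠ 0` (`w′ = u₂/u₁`).
DEFINITION (NEW object). [folklore] -/
noncomputable def upperChart (G : ℕ → R) (m : ℕ) : Polynomial R :=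
  ∑ i ∈ Finset.range (m + 1), Polynomial.C (G i) * Polynomial.X ^ (m - i)

/-- **RELATIVE SIMPLICITY over the curve** [g19] `RelSimple P M φ` (`P = 𝔭` the curve prime, `M = 𝔪_y`): at every
closed point `𝔑`
of the fibre line `M·R[X]` containing `φ`, `φ ∉ 𝔑² + 𝔭·R[X]` — i.e. the closed subscheme `V(φ̄) ⊂ 𝔸¹_A`, `A = R/𝔭 = 𝒪_{C,y}`, is
REGULAR at its points over `y` (`A[X]_𝔑/(φ̄)` regular ⟺ `φ̄ ∉ 𝔑̄²`).  Same grammar as g15's `SideClean`; the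
polynomial read is the
`C`-relative face, and the reading is over the DVR `A`, not over `k(y)`.  DEFINITION (NEW class predicate).
(Sources: CossartJannsenSaito2020
Ch. 2; folklore.) -/
def RelSimple (P M : Ideal R) (φ : Polynomial R) : Prop :=
  ∀ N : Ideal (Polynomial R), N.IsMaximal → Ideal.map (Polynomial.C : R →+* Polynomial R) M ≤ N → φ ∈ N →
    φ ∉ N ^ 2 ⊔ Ideal.map (Polynomial.C : R →+* Polynomial R) P

/-- **SPREAD SHAPE** [g19] (`SpreadShape P M c G g f n m`) over a commutative ring `R` (`= 𝒪_{Y,y}`) with ideals `P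
= 𝔭 ⊆ M = 𝔪_y` and
curve parameters `c = (z, u₁, u₂)`: `f = zⁿ + binForm u₁ u₂ G m + g`, the tail `g` STRICTLY ABOVE the face (`g ∈
Q(mn + 1)`, the tree's
`qWeighted c m n`), the arithmetic regime `m + 1 = (q + 1)·n`, `q ≥ 1` (`m mod n = n − 1`; for `n = 2`: `m` odd `≥ 3`), and the
REGULARITY OF THE SECONDARY CURVE at its points over `y` in both charts (`RelSimple`).  No residue-field genericity,
no separability,
no side/stray clause.  DEFINITION (NEW class predicate). (Sources: Hironaka1967; CossartJannsenSaito2020 Ch. 8;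
CossartPiltant2008 Prop. 4.2.) -/
def SpreadShape (P M : Ideal R) (c : Fin 3 → R) (G : ℕ → R) (g f : R) (n m : ℕ) : Prop :=
  f = c 0 ^ n + binForm (c 1) (c 2) G m + g ∧ g ∈ qWeighted c m n (m * n + 1) ∧
    (∃ q : ℕ, 1 ≤ q ∧ m + 1 = (q + 1) * n) ∧
    RelSimple P M (lowerChart G m) ∧ RelSimple P M (upperChart G m)

section SpreadKernel

/-- **LOWER CHART IDENTITY** [g19; KERNEL (PROVED), any commutative ring]: substituting `u₁ = w·u`, `u₂ = u` factors
`u^m` off the face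
and leaves the lower chart polynomial evaluated at `w`: `Φ(wu, u) = u^m·φ₁(w)` — the face REPRODUCES along the
`ℙ¹`-bundle `Σ_j` with
the coordinate `w`, at every stage of the tower (§Γ.1). [folklore] -/
theorem binForm_lower (G : ℕ → R) (w u : R) (m : ℕ) :
    binForm (w * u) u G m = u ^ m * (lowerChart G m).eval w := by
  unfold binForm lowerChart
  rw [Polynomial.eval_finsetSum, Finset.mul_sum]
  refine Finset.sum_congr rfl fun i hi => ?_
  have hi' : i ≤ m := Nat.lt_succ_iff.mp (Finset.mem_range.mp hi)
  obtain ⟨j, rfl⟩ := Nat.exists_eq_add_of_le hi'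
  simp only [Polynomial.eval_mul, Polynomial.eval_C, Polynomial.eval_pow, Polynomial.eval_X, Nat.add_sub_cancel_left,
    mul_pow, pow_add]
  ring

/-- **UPPER CHART IDENTITY** [g19; KERNEL (PROVED)]: `Φ(u, w′u) = u^m·φ₂(w′)`. [folklore] -/
theorem binForm_upper (G : ℕ → R) (u w : R) (m : ℕ) :
    binForm u (w * u) G m = u ^ m * (upperChart G m).eval w := by
  unfold binForm upperChart
  rw [Polynomial.eval_finsetSum, Finset.mul_sum]
  refine Finset.sum_congr rfl fun i hi => ?_
  have hi' : i ≤ m := Nat.lt_succ_iff.mp (Finset.mem_range.mp hi)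
  obtain ⟨j, rfl⟩ := Nat.exists_eq_add_of_le hi'
  simp only [Polynomial.eval_mul, Polynomial.eval_C, Polynomial.eval_pow, Polynomial.eval_X, Nat.add_sub_cancel_left,
    mul_pow, pow_add]
  ring

/-- **SECTION CHART of the corner** [g19; KERNEL (PROVED)]: `z = z_j·u^j` turns `zⁿ` into `u^{jn}·z_jⁿ` — after `j` controlled
divisions by `uⁿ` the corner `z_jⁿ` survives with coefficient `1` (the letter `Zⁿ ∈ B(Z, U)` of the key step). [folklore] -/
theorem corner_chart (z u : R) (j n : ℕ) : (z * u ^ j) ^ n = u ^ (j * n) * z ^ n := by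
  rw [mul_pow, ← pow_mul, mul_comm]

/-- **VACUOUS CHART** [g19; KERNEL (PROVED)]: a chart polynomial `≡ 1 mod 𝔪_y·R[X]` lies in NO closed point of the
fibre line — the
letter `RelSimple` holds vacuously (the upper chart at the core of INSEP-v: `φ₂ = v·X⁵ + 1`). [folklore] -/
theorem relSimple_of_sub_one_mem (P M : Ideal R) (φ : Polynomial R)
    (h : φ - 1 ∈ Ideal.map (Polynomial.C : R →+* Polynomial R) M) : RelSimple P M φ := by
  intro N hN hMN hφ _
  apply hN.ne_top
  rw [Ideal.eq_top_iff_one]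
  have h1 : φ - (φ - 1) ∈ N := N.sub_mem hφ (hMN h)
  rwa [sub_sub_cancel] at h1

/-- **THE CORE TEST** [g19; KERNEL (PROVED), any commutative ring, `M` maximal]: for the PURE secondary form `u₁^m +
a·u₂^m` the lower
chart is `X^m + C a`, and if `a ∈ M` with `a ∉ M² + P` — `ā` is a UNIFORMISER of the discrete valuation ring `A = R/P` — then
`RelSimple P M (X^m + C a)`: the `m`-fold root of the residue form MOVES TRANSVERSALLY AT UNIT SPEED, the secondary curve
`V(w^m + ā) ⊂ 𝔸¹_A` is regular (totally ramified of index `m` over the curve).  Proof: a maximal `N ⊇ (M, φ)`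
contains `X`; evaluation
at `0` maps `N` into `M` (else `1 ∈ N`), so `N² + P·R[X]` dies in `R/(M² + P)` while `φ ↦ ā ≠ 0`.  This is the JUMP
POINT of the window
(INSEP-v's core: `m = 5`, `a = v`). [folklore] -/
theorem relSimple_X_pow_add_C {P M : Ideal R} (hM : M.IsMaximal) {a : R} {m : ℕ} (hm : m ≠ 0) (haM : a ∈ M)
    (ha : a ∉ M ^ 2 ⊔ P) : RelSimple P M (Polynomial.X ^ m + Polynomial.C a) := by
  intro N hN hMN hφ hmem
  have hCa : Polynomial.C a ∈ N := hMN (Ideal.mem_map_of_mem _ haM)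
  have hX : (Polynomial.X : Polynomial R) ∈ N := by
    refine hN.isPrime.mem_of_pow_mem m ?_
    have h := N.sub_mem hφ hCa
    rwa [add_sub_cancel_right] at h
  -- evaluation at `0`
  let ev : Polynomial R →+* R := Polynomial.evalRingHom 0
  have hev_sub : ∀ p : Polynomial R, p - Polynomial.C (ev p) ∈ N := by
    intro p
    have hdvd : (Polynomial.X : Polynomial R) ∣ p - Polynomial.C (ev p) := by
      rw [Polynomial.X_dvd_iff]
      simp [ev, Polynomial.coeff_zero_eq_eval_zero]
    obtain ⟨r, hr⟩ := hdvd
    rw [hr]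
    exact N.mul_mem_right r hX
  have hevN : ∀ p ∈ N, ev p ∈ M := by
    intro p hp
    by_contra hpM
    obtain ⟨y, i, hi, hyi⟩ := hM.exists_inv hpM
    apply hN.ne_top
    rw [Ideal.eq_top_iff_one]
    have hqN : Polynomial.C y * p + Polynomial.C i ∈ N :=
      N.add_mem (N.mul_mem_left _ hp) (hMN (Ideal.mem_map_of_mem _ hi))
    have hevq : ev (Polynomial.C y * p + Polynomial.C i) = 1 := by
      simpa [ev] using hyi
    have h1 := N.sub_mem hqN (hev_sub (Polynomial.C y * p + Polynomial.C i))
    rwa [hevq, map_one, sub_sub_cancel] at h1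
  -- the composite `θ = (mod M² ⊔ P) ∘ ev` kills `N² ⊔ P·R[X]` but not `φ`
  let θ : Polynomial R →+* R ⧸ (M ^ 2 ⊔ P) := (Ideal.Quotient.mk (M ^ 2 ⊔ P)).comp ev
  have hker : N ^ 2 ⊔ Ideal.map (Polynomial.C : R →+* Polynomial R) P ≤ RingHom.ker θ := by
    refine sup_le ?_ ?_
    · have hNle : N ≤ Ideal.comap ev M := fun p hp => hevN p hp
      calc N ^ 2 ≤ Ideal.comap ev M ^ 2 := Ideal.pow_right_mono hNle 2
        _ ≤ Ideal.comap ev (M ^ 2) := Ideal.le_comap_pow ev 2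
        _ ≤ RingHom.ker θ := by
          intro p hp
          rw [Ideal.mem_comap] at hp
          rw [RingHom.mem_ker]
          change Ideal.Quotient.mk (M ^ 2 ⊔ P) (ev p) = 0
          rw [Ideal.Quotient.eq_zero_iff_mem]
          exact Ideal.mem_sup_left hp
    · rw [Ideal.map_le_iff_le_comap]
      intro r hr
      rw [Ideal.mem_comap, RingHom.mem_ker]
      change Ideal.Quotient.mk (M ^ 2 ⊔ P) (ev (Polynomial.C r)) = 0
      rw [Ideal.Quotient.eq_zero_iff_mem]
      have hevC : ev (Polynomial.C r) = r := by simp [ev]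
      rw [hevC]
      exact Ideal.mem_sup_right hr
  have hθφ : θ (Polynomial.X ^ m + Polynomial.C a) = 0 := hker hmem
  change Ideal.Quotient.mk (M ^ 2 ⊔ P) (ev (Polynomial.X ^ m + Polynomial.C a)) = 0 at hθφ
  rw [Ideal.Quotient.eq_zero_iff_mem] at hθφ
  have heva : ev (Polynomial.X ^ m + Polynomial.C a) = a := by
    simp [ev, zero_pow hm]
  rw [heva] at hθφ
  exact ha hθφ

/-- **THE CORE TEST IS SHARP — NEGATIVE KERNEL** [g19; KERNEL (PROVED), any commutative ring, `M` maximal]: if the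
moving coefficient
lies in `M²` (INSEP-v³: `a = v³`; INSEP-vv: `v²`), the letter FAILS: the closed point `𝔑 ⊇ (M, X)` of the fibre line contains
`X^m + C b` (`m ≥ 2`) inside `𝔑²` — the secondary curve `w^m + b̄ = 0` is SINGULAR at `w = 0` over `y` (for `b̄ =
v̄³`: the `(3,5)`-cusp).
Proof: `J := M·R[X] + (X) ≠ ⊤` (the character `X ↦ 0`, `R → R/M` kills it), so a maximal `𝔑 ⊇ J` exists, and `X^m + C b ∈ J² ⊆ 𝔑²`.
[folklore] -/
theorem not_relSimple_X_pow_add_C_of_mem_sq {P M : Ideal R} (hM : M.IsMaximal) {b : R} {m : ℕ} (hm : 2 ≤ m)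
    (hb : b ∈ M ^ 2) : ¬ RelSimple P M (Polynomial.X ^ m + Polynomial.C b) := by
  intro h
  let J : Ideal (Polynomial R) := Ideal.map (Polynomial.C : R →+* Polynomial R) M ⊔ Ideal.span {Polynomial.X}
  have hJ : J ≠ ⊤ := by
    intro htop
    let θ₀ : Polynomial R →+* R ⧸ M := (Ideal.Quotient.mk M).comp (Polynomial.evalRingHom 0)
    have hle : J ≤ RingHom.ker θ₀ := by
      refine sup_le ?_ ?_
      · rw [Ideal.map_le_iff_le_comap]
        intro r hr
        simp only [Ideal.mem_comap, RingHom.mem_ker, θ₀, RingHom.coe_comp, Function.comp_apply,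
          Polynomial.coe_evalRingHom, Polynomial.eval_C, Ideal.Quotient.eq_zero_iff_mem]
        exact hr
      · rw [Ideal.span_le, Set.singleton_subset_iff, SetLike.mem_coe, RingHom.mem_ker]
        simp only [θ₀, RingHom.coe_comp, Function.comp_apply, Polynomial.coe_evalRingHom, Polynomial.eval_X, map_zero]
    have h1 : (1 : Polynomial R) ∈ RingHom.ker θ₀ := hle ((Ideal.eq_top_iff_one J).mp htop)
    rw [RingHom.mem_ker, map_one] at h1
    apply hM.ne_top
    rw [Ideal.eq_top_iff_one]
    exact Ideal.Quotient.eq_zero_iff_mem.mp (by rw [map_one]; exact h1)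
  obtain ⟨N, hN, hJN⟩ := Ideal.exists_le_maximal J hJ
  have hX : (Polynomial.X : Polynomial R) ∈ J := Ideal.mem_sup_right (Ideal.mem_span_singleton_self _)
  have hφJ : Polynomial.X ^ m + Polynomial.C b ∈ J ^ 2 := by
    refine (J ^ 2).add_mem ?_ ?_
    · obtain ⟨k, rfl⟩ := Nat.exists_eq_add_of_le hm
      rw [pow_add]
      exact Ideal.mul_mem_right _ _ (Ideal.pow_mem_pow hX 2)
    · have hCb : Polynomial.C b ∈ (Ideal.map (Polynomial.C : R →+* Polynomial R) M) ^ 2 := by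
        rw [← Ideal.map_pow]
        exact Ideal.mem_map_of_mem _ hb
      exact Ideal.pow_right_mono le_sup_left 2 hCb
  have hφN2 : Polynomial.X ^ m + Polynomial.C b ∈ N ^ 2 := Ideal.pow_right_mono hJN 2 hφJ
  have hφN : Polynomial.X ^ m + Polynomial.C b ∈ N := Ideal.pow_le_self two_ne_zero hφN2
  exact h N hN (le_sup_left.trans hJN) hφN (Ideal.mem_sup_left hφN2)

/-- **COEFFICIENTS OF THE PURE SECONDARY FORM** `u₁^m + a·u₂^m` [g19]: `G m = 1`, `G 0 = a`, all other `G i = 0`.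
DEFINITION (support).
[folklore] -/
def pureCoeff (a : R) (m : ℕ) : ℕ → R := fun i => if i = m then 1 else if i = 0 then a else 0

/-- The pure form IS `u₁^m + a·u₂^m`.  KERNEL (PROVED). [folklore] -/
theorem binForm_pureCoeff (u₁ u₂ a : R) {m : ℕ} (hm : m ≠ 0) :
    binForm u₁ u₂ (pureCoeff a m) m = u₁ ^ m + a * u₂ ^ m := by
  unfold binForm
  rw [Finset.sum_eq_add_of_mem m 0 (by simp) (by simp) hm]
  · simp [pureCoeff, hm.symm]
  · intro c _ hc
    simp [pureCoeff, hc.1, hc.2]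

end SpreadKernel

end SpreadRing

end Summit.ResolutionOfSingularities.ResolutionOfSingularities.Theorems.SpreadCut
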